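import Summits.QuantumFields.BalabanUV.Beta.GAN24.CombContactRefineBThree
import Summits.QuantumFields.BalabanUV.Beta.GAN24.ContactRefineBHolds

/-!
# `BalabanUV.Beta.GAN24.CombContactRefineBHolds` — row G-an2-4 ∕ (CONV-C), TRANSFER-III, (III′) S-slot (b), the Wilson contact RATE END `hCTd′`, step CT-4c-B AT THE COMB CHART, THE WRAPPER:
# **THE THREE B-ATOMS OF THE (III′) CONTACT CELLS ACROSS TWO CONSECUTIVE TOWERS IN CLOSED GEOMETRIC FORM `K·ϑ^k·Zl·e^{−(κ∕12)·spread}`, `ϑ < 1`, FROM `2 ≤ Lc` ALONE, FOR EVERY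
# ROOT PAIR** — the (III′) twin of leaf-02 g50's (E) `ContactRefineBHolds`: the letter families of MY `CombContactRefineBThree` discharged by their suppliers at ONE common rate
# ((N1) + tent bound: MY (E) `ContactAssembly.exists_common_letters`; ε₁: MY (E) `RespStepRefine`; ε₃: road-P2's `ContactTentRefine`; the conjugated site letter: MY
# `CombContactGaugeRefine.exists_combGauge_refine_site`; the face letter `F = Σ_{r′∈box} faceWtSum r′ Lc`), leaf-02's `exists_geometric_majorant` BY NAME (plus `(Lc^{k+2})⁻¹ ≤ ϑ^k`,
# `(k+2)·(Lc^{k+1})⁻¹ ≤ 2·Kρ·ϑ^k`).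

NOT IN PRINT; OUR BOOKKEEPING (leaf prover `b2b-balaban-gan24-formalise-leaf-01` gen 89; leaf-02's (E) text transformed BY NAME; [folklore]; 0 `def`, 0 cited facts, 0 `def … : Prop`, 0 sorry).
HONEST FRAMING (verbatim): «discharging `BetaPertH` makes Bałaban's UV stability UNCONDITIONAL — a real constructive-QFT result; it is NOT the continuum limit and NOT the Clay problem.»
HONEST DEPENDENCY (verbatim): «continuum YM on T⁴ ⇐ BetaPertH ∧ nine spine estimates (0/9 proved); BetaPertH ⇐ (D1) ∧ (D4) ∧ CAP+tail; G-an2-4 gates asym, D1 and NE2/3/4.»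
* §1 **`exists_common_refine_letters_three`**; §2 **`exists_atomTip_refine_three`**, **`exists_atomMid_refine_three`**, **`exists_atomSite_refine_three`** (every root pair `r, rr ∈ box`).
WHAT IS LEFT of `hCTd′`: the (III′) twins of road-P2's P-atoms `ContactRefinePThree ∕ PThreePack`, `ContactCauchyCells`, `ContactCauchyAssembly(+Holds)`.  Discharges NOTHING of `hCTd′` by itself;
NEVER «G-an2-4 closed» as (CONV-C); NOT D1, NOT BetaPertH, NOT continuum, NOT Clay.  2026-08-28; no existing file touched.
-/

noncomputable section

open Finset
open scoped BigOperators
open Literature.MathematicalPhysics.QuantumFieldTheory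
open Literature.MathematicalPhysics.QuantumFieldTheory.LatticeForm (quo)
open Literature.MathematicalPhysics.QuantumFieldTheory.Balaban1983to89
open Literature.MathematicalPhysics.QuantumFieldTheory.Balaban1983to89.Beta
open B4ContourShift (supNorm supNorm_nonneg)
open ExpKernelCalculus (Zl Zl_nonneg)
open AffineAveraging (Form0 Form1 Site box toSite)
open AffineReproduction (contourSumAdj)
open AveragingContours (blk)
open KernelSpecInstance (wΦ)
open B6BondElimination (unitVec unitVec_apply)
open KKTFluctuationKernel (delta1)
open BalabanCompositeJets (respStep)
open Summit.QuantumFields.BalabanUV.Beta.AxialProjectorBlockMean (bmGaugeAt)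
open Summit.QuantumFields.BalabanUV.Beta.GAN24.RespStepBmDecompPsi (Psi)
open Summit.QuantumFields.BalabanUV.Beta.GAN24.ContactGaugeStaircaseCauchy (exp_env_mono)
open Summit.QuantumFields.BalabanUV.Beta.GAN24.StaircaseFaceDensity (succ_pow_mul_pow_le_mul_pow)
open Summit.QuantumFields.BalabanUV.Beta.SymCorrectorFace (faceWtSum faceWtSum_nonneg)
open Summit.QuantumFields.BalabanUV.Beta.GAN24.CombLegChainGauge (PsiFace)
open Summit.QuantumFields.BalabanUV.Beta.GAN24.CombContactRefineBThree (abs_atomTip_refine_le abs_atomMid_refine_le abs_atomSite_refine_le)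

namespace Summit.QuantumFields.BalabanUV.Beta.GAN24.CombContactRefineBHolds

variable {Lc : ℕ} [NeZero Lc]

/-! ## §1 The five letter families at one rate -/

/-- NOT IN PRINT; OUR BOOKKEEPING.  **THE FIVE LETTER FAMILIES OF THE B-ATOMS AT ONE RATE** (`d = 3`, `2 ≤ Lc`): (N1), the tent bound, the leg refinement ε₁, the tent
refinement ε₃ and the gauge SITE refinement εψ, all at the minimum `κ` of their suppliers' rates (envelopes are monotone in the rate). -/
theorem exists_common_refine_letters_three (hLc : 2 ≤ Lc) :
    ∃ κ C Φ₀ c₁ θ₁ A B θt αd α₀ θ F : ℝ, 0 < κ ∧ 0 ≤ C ∧ 0 ≤ Φ₀ ∧ 0 ≤ c₁ ∧ 0 ≤ θ₁ ∧ θ₁ < 1 ∧ 0 ≤ A ∧ 0 ≤ B ∧ 0 ≤ θt ∧ θt < 1 ∧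
      0 ≤ αd ∧ 0 ≤ α₀ ∧ 0 ≤ θ ∧ θ < 1 ∧ (∀ (r : Fin (3 + 1) → ℕ), r ∈ box (3 + 1) Lc → faceWtSum r Lc ≤ F) ∧
      (∀ (m k : ℕ) (μ : Fin (3 + 1)) (z : Site (3 + 1)) (l'' : Fin (3 + 1)) (w' : Site (3 + 1)),
        |respStep (d := 3) (Lc ^ m) (Lc ^ (m + k + 1)) μ z l'' w'| ≤
          C * ((Lc : ℝ) ^ (5 * (k + 1)))⁻¹ * Real.exp (-(κ * supNorm (quo (Lc ^ (k + 1)) w' - z)))) ∧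
      (∀ (k : ℕ) (μ : Fin (3 + 1)) (z : Site (3 + 1)) (κ' : Fin (3 + 1)) (u : Site (3 + 1)),
        |contourSumAdj (Lc ^ (k + 1)) (fun κ' y => wΦ (N := Lc ^ (k + 1)) κ' μ (y - z)) κ' u|
          ≤ (Lc ^ (k + 1) : ℕ) * (Φ₀ * ((Lc : ℝ) ^ (8 * (k + 1)))⁻¹) * Real.exp κ * Real.exp (-(κ * supNorm (quo (Lc ^ (k + 1)) u - z)))) ∧
      (∀ (k : ℕ) (μ : Fin (3 + 1)) (z : Site (3 + 1)) (l : Fin (3 + 1)) (v : Site (3 + 1)),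
        |(Lc : ℝ) ^ (3 + 2) * respStep (d := 3) 1 (Lc ^ (k + 1 + 1)) μ z l v - respStep (d := 3) 1 (Lc ^ (k + 1)) μ z l (quo Lc v)|
          ≤ c₁ * θ₁ ^ k * (((Lc : ℝ) ^ (k + 1)) ^ (3 + 2))⁻¹ * Real.exp (-(κ * supNorm (quo (Lc ^ (k + 1 + 1)) v - z)))) ∧
      (∀ (k : ℕ) (μ : Fin (3 + 1)) (z : Site (3 + 1)) (κ' : Fin (3 + 1)) (x : Site (3 + 1)),
        |(((Lc ^ (k + 1 + 1) : ℕ) : ℝ))⁻¹ *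
              contourSumAdj (Lc ^ (k + 1 + 1))
                (fun κ'' y => (((Lc : ℝ) ^ (k + 1 + 1)) ^ (2 * (3 + 1))) * wΦ (N := Lc ^ (k + 1 + 1)) (d := 3) κ'' μ (y - z)) κ' x
            - (((Lc ^ (k + 1) : ℕ) : ℝ))⁻¹ *
              contourSumAdj (Lc ^ (k + 1))
                (fun κ'' y => (((Lc : ℝ) ^ (k + 1)) ^ (2 * (3 + 1))) * wΦ (N := Lc ^ (k + 1)) (d := 3) κ'' μ (y - z)) κ' (quo Lc x)|
          ≤ (A * θt ^ k + B * (((Lc ^ (k + 1) : ℕ) : ℝ))⁻¹) * Real.exp (-(κ * supNorm (quo (Lc ^ (k + 1)) (quo Lc x) - z)))) ∧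
      (∀ (r : Fin (3 + 1) → ℕ), r ∈ box (3 + 1) Lc → ∀ (rr : Fin (3 + 1) → ℕ), rr ∈ box (3 + 1) Lc → ∀ (k : ℕ) (μ : Fin (3 + 1)) (z : Site (3 + 1)) (u' : Site (3 + 1)),
        |(Psi (toSite rr) Lc 0 (k + 1) (delta1 μ z) u' + PsiFace r (toSite rr) Lc 0 (k + 1) (delta1 μ z) u' - bmGaugeAt (toSite rr) (respStep (d := 3) 1 (Lc ^ (k + 2)) μ z) Lc u')
            - ((Lc : ℝ) ^ (3 + 1))⁻¹ *
              (Psi (toSite rr) Lc 0 k (delta1 μ z) (blk Lc u') + PsiFace r (toSite rr) Lc 0 k (delta1 μ z) (blk Lc u') - bmGaugeAt (toSite rr) (respStep (d := 3) 1 (Lc ^ (k + 1)) μ z) Lc (blk Lc u'))|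
          ≤ (3 * αd * θ ^ k * (Lc : ℝ) ^ (k + 2) + 2 * α₀) * ((Lc : ℝ) ^ (5 * (k + 2)))⁻¹ *
            Real.exp (-(κ * supNorm (quo (Lc ^ (k + 2)) u' - z)))) := by
  obtain ⟨κ₀, Ca, KE, Φ₀, hκ₀, hCa, -, hΦ₀, hN1, -, -, ht⟩ := ContactAssembly.exists_common_letters (Lc := Lc) hLc
  obtain ⟨c₁, θ₁, κ₂, hc₁, hθ₁, hθ₁1, hκ₂, hdB⟩ := RespStepRefine.exists_respStep_refine (Lc := Lc) hLc
  obtain ⟨A, B, δ, θt, hδ, hθt, hθt1, hdt⟩ := ContactTentRefine.exists_tent_refine_three (Lc := Lc) hLc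
  obtain ⟨κg, α₀, αd, θg, hκg, hα₀, hαd, hθg, hθg1, hdl⟩ := CombContactGaugeRefine.exists_combGauge_refine_site (Lc := Lc) hLc
  -- the common rate and the merged (N1) constant
  set κ : ℝ := min (min κ₀ κ₂) (min δ κg) with hκdef
  have hκpos : 0 < κ := lt_min (lt_min hκ₀ hκ₂) (lt_min hδ hκg)
  have hκ0 : κ ≤ κ₀ := (min_le_left _ _).trans (min_le_left _ _)
  have hκ2 : κ ≤ κ₂ := (min_le_left _ _).trans (min_le_right _ _)
  have hκδ : κ ≤ δ := (min_le_right _ _).trans (min_le_left _ _)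
  have hκg' : κ ≤ κg := (min_le_right _ _).trans (min_le_right _ _)
  set C : ℝ := Ca with hCdef
  have hCaC : Ca ≤ C := le_rfl
  have hC : 0 ≤ C := hCa
  have hL0 : (0 : ℝ) ≤ (Lc : ℝ) := Nat.cast_nonneg _
  refine ⟨κ, C, Φ₀ * Real.exp κ₀, c₁, θ₁, |A|, |B|, θt, αd, α₀, θg, ∑ r' ∈ box (3 + 1) Lc, faceWtSum r' Lc, hκpos, hC, by positivity, hc₁, hθ₁, hθ₁1,
    abs_nonneg _, abs_nonneg _, hθt, hθt1, hαd, hα₀, hθg, hθg1, fun r hr => Finset.single_le_sum (fun r' _ => faceWtSum_nonneg r' Lc) hr,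
    fun m k μ z l'' w' => ?_, fun k μ z κ' u => ?_, fun k μ z l v => ?_, fun k μ z κ' x => ?_, fun r hr rr hrr k μ z u' => ?_⟩
  · -- (N1) at the common rate, constant merged
    refine (hN1 m k μ z l'' w').trans ?_
    have hx := supNorm_nonneg (quo (Lc ^ (k + 1)) w' - z)
    have h1 := exp_env_mono hκ0 hx
    have h2 : 0 ≤ ((Lc : ℝ) ^ (5 * (k + 1)))⁻¹ := by positivity
    calc Ca * ((Lc : ℝ) ^ (5 * (k + 1)))⁻¹ * Real.exp (-(κ₀ * supNorm (quo (Lc ^ (k + 1)) w' - z)))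
        ≤ Ca * ((Lc : ℝ) ^ (5 * (k + 1)))⁻¹ * Real.exp (-(κ * supNorm (quo (Lc ^ (k + 1)) w' - z))) :=
          mul_le_mul_of_nonneg_left h1 (mul_nonneg hCa h2)
      _ ≤ C * ((Lc : ℝ) ^ (5 * (k + 1)))⁻¹ * Real.exp (-(κ * supNorm (quo (Lc ^ (k + 1)) w' - z))) := by gcongr
  · -- the tent bound at the common rate: `Φ₀ ↦ Φ₀·e^{κ₀}`, `e^{κ₀} ↦ e^{κ} ≥ 1`
    refine (ht k μ z κ' u).trans ?_
    have hx := supNorm_nonneg (quo (Lc ^ (k + 1)) u - z)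
    have h1 := exp_env_mono hκ0 hx
    have h2 : (1 : ℝ) ≤ Real.exp κ := Real.one_le_exp hκpos.le
    have h3 : 0 ≤ ((Lc ^ (k + 1) : ℕ) : ℝ) * (Φ₀ * ((Lc : ℝ) ^ (8 * (k + 1)))⁻¹) * Real.exp κ₀ := by positivity
    calc ((Lc ^ (k + 1) : ℕ) : ℝ) * (Φ₀ * ((Lc : ℝ) ^ (8 * (k + 1)))⁻¹) * Real.exp κ₀ * Real.exp (-(κ₀ * supNorm (quo (Lc ^ (k + 1)) u - z)))
        ≤ ((Lc ^ (k + 1) : ℕ) : ℝ) * (Φ₀ * ((Lc : ℝ) ^ (8 * (k + 1)))⁻¹) * Real.exp κ₀ * Real.exp (-(κ * supNorm (quo (Lc ^ (k + 1)) u - z))) :=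
          mul_le_mul_of_nonneg_left h1 h3
      _ = ((Lc ^ (k + 1) : ℕ) : ℝ) * (Φ₀ * Real.exp κ₀ * ((Lc : ℝ) ^ (8 * (k + 1)))⁻¹) * 1 * Real.exp (-(κ * supNorm (quo (Lc ^ (k + 1)) u - z))) := by
          ring
      _ ≤ ((Lc ^ (k + 1) : ℕ) : ℝ) * (Φ₀ * Real.exp κ₀ * ((Lc : ℝ) ^ (8 * (k + 1)))⁻¹) * Real.exp κ *
            Real.exp (-(κ * supNorm (quo (Lc ^ (k + 1)) u - z))) := by gcongr
  · -- ε₁ at the common rate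
    refine (hdB k μ z l v).trans ?_
    have hx := supNorm_nonneg (quo (Lc ^ (k + 1 + 1)) v - z)
    exact mul_le_mul_of_nonneg_left (exp_env_mono hκ2 hx) (by positivity)
  · -- ε₃ at the common rate, `A, B ↦ |A|, |B|`
    refine (hdt k μ z κ' x).trans ?_
    have hx := supNorm_nonneg (quo (Lc ^ (k + 1)) (quo Lc x) - z)
    have h1 := exp_env_mono hκδ hx
    have hN0 : 0 ≤ (((Lc ^ (k + 1) : ℕ) : ℝ))⁻¹ := by positivity
    have hAB : A * θt ^ k + B * (((Lc ^ (k + 1) : ℕ) : ℝ))⁻¹ ≤ |A| * θt ^ k + |B| * (((Lc ^ (k + 1) : ℕ) : ℝ))⁻¹ :=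
      add_le_add (mul_le_mul_of_nonneg_right (le_abs_self A) (pow_nonneg hθt k)) (mul_le_mul_of_nonneg_right (le_abs_self B) hN0)
    have hAB0 : 0 ≤ |A| * θt ^ k + |B| * (((Lc ^ (k + 1) : ℕ) : ℝ))⁻¹ := by positivity
    calc (A * θt ^ k + B * (((Lc ^ (k + 1) : ℕ) : ℝ))⁻¹) * Real.exp (-(δ * supNorm (quo (Lc ^ (k + 1)) (quo Lc x) - z)))
        ≤ (|A| * θt ^ k + |B| * (((Lc ^ (k + 1) : ℕ) : ℝ))⁻¹) * Real.exp (-(δ * supNorm (quo (Lc ^ (k + 1)) (quo Lc x) - z))) :=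
          mul_le_mul_of_nonneg_right hAB (Real.exp_pos _).le
      _ ≤ (|A| * θt ^ k + |B| * (((Lc ^ (k + 1) : ℕ) : ℝ))⁻¹) * Real.exp (-(κ * supNorm (quo (Lc ^ (k + 1)) (quo Lc x) - z))) :=
          mul_le_mul_of_nonneg_left h1 hAB0
  · -- εψ at the common rate
    refine (hdl r hr rr hrr k μ z u').trans ?_
    have hx := supNorm_nonneg (quo (Lc ^ (k + 2)) u' - z)
    exact mul_le_mul_of_nonneg_left (exp_env_mono hκg' hx) (by positivity)

/-! ## §3 The three B-atom two-tower differences in closed geometric form -/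

/-- NOT IN PRINT; OUR BOOKKEEPING.  **THE TIP B-ATOM OF THE CONTACT CELLS ACROSS TWO CONSECUTIVE TOWERS IS GEOMETRICALLY SMALL, UNCONDITIONALLY** (`d = 3`, `2 ≤ Lc`,
every in-block root, every `k`, all cell data): `|N′^{12}·atomTip_{k+1} − N^{12}·atomTip_k| ≤ K·ϑ^k·Zl 4 (κ∕16)·e^{−(κ∕12)(‖u′−x′‖∞+‖z′−x′‖∞)}`, `ϑ < 1`. -/
theorem exists_atomTip_refine_three (hLc : 2 ≤ Lc) :
    ∃ κ K ϑ : ℝ, 0 < κ ∧ 0 ≤ K ∧ 0 ≤ ϑ ∧ ϑ < 1 ∧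
      ∀ (r : Fin (3 + 1) → ℕ), r ∈ box (3 + 1) Lc → ∀ (rr : Fin (3 + 1) → ℕ), rr ∈ box (3 + 1) Lc →
        ∀ (k : ℕ) (κ' : Fin (3 + 1)) (u' : Site (3 + 1)) (α : Fin (3 + 1)) (x' : Site (3 + 1)) (β : Fin (3 + 1)) (z' : Site (3 + 1)),
          |((Lc : ℝ) ^ (k + 2)) ^ 12 *
          (∑' x : Site (3 + 1), ∑ κ,
            (Psi (toSite rr) Lc 0 (k + 1) (delta1 α x') + PsiFace r (toSite rr) Lc 0 (k + 1) (delta1 α x') - bmGaugeAt (toSite rr) (respStep (d := 3) 1 (Lc ^ (k + 2)) α x') Lc) (x + unitVec κ)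
              * respStep (d := 3) 1 (Lc ^ (k + 2)) κ' u' κ x
              * contourSumAdj (Lc ^ (k + 2)) (fun l y => wΦ (N := Lc ^ (k + 2)) (d := 3) l β (y - z')) κ x)
          - ((Lc : ℝ) ^ (k + 1)) ^ 12 *
          (∑' cc : Site (3 + 1), ∑ κ,
            (Psi (toSite rr) Lc 0 k (delta1 α x') + PsiFace r (toSite rr) Lc 0 k (delta1 α x') - bmGaugeAt (toSite rr) (respStep (d := 3) 1 (Lc ^ (k + 1)) α x') Lc) (cc + unitVec κ)
              * respStep (d := 3) 1 (Lc ^ (k + 1)) κ' u' κ cc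
              * contourSumAdj (Lc ^ (k + 1)) (fun l y => wΦ (N := Lc ^ (k + 1)) (d := 3) l β (y - z')) κ cc)|
          ≤ K * ϑ ^ k * (Zl (3 + 1) (κ / (4 * ((((3 : ℕ) : ℝ)) + 1))) * Real.exp (-(κ / 12) * (supNorm (u' - x') + supNorm (z' - x')))) := by
  obtain ⟨κ, C, Φ₀, c₁, θ₁, A, B, θt, αd, α₀, θ, F, hκ, hC, hΦ, hc₁, hθ₁, hθ₁1, hA, hB, hθt, hθt1, hαd, hα₀, hθ, hθ1, hF, hN1, ht, hdB, hdt, hdl⟩ :=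
    exists_common_refine_letters_three (Lc := Lc) hLc
  have hF0 : 0 ≤ F := (faceWtSum_nonneg _ Lc).trans (hF _ (AveragingContoursRooted.ctrOff_mem_box (by omega)))
  obtain ⟨ϑ, Kρ, hϑ0, hϑ1, hKρ, hmaj⟩ := ContactRefineBHolds.exists_geometric_majorant (Lc := Lc) hLc hθ₁ hθ₁1 hθt hθt1 hθ hθ1
  have hKρ0 : 0 ≤ Kρ := zero_le_one.trans hKρ
  have hL0 : (0 : ℝ) ≤ (Lc : ℝ) := Nat.cast_nonneg _
  set K : ℝ := ((((3 : ℕ) : ℝ)) + 1) *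
      (Real.exp κ * ((2 * (8 * (Lc : ℝ) * C + F * (1 + 8 * (Lc : ℝ) * (Real.exp κ + 1)) * C)) * (c₁ * 1) * (Φ₀ * Real.exp κ) + (2 * (8 * (Lc : ℝ) * C + F * (1 + 8 * (Lc : ℝ) * (Real.exp κ + 1)) * C)) * C * (A * 1 + B * 1) + (3 * αd * 1 + 2 * α₀ * 1) * C * (Φ₀ * Real.exp κ))
        + 2 * Real.exp κ * ((2 * Kρ * 1) * ((8 * (Lc : ℝ) * C + F * (1 + 8 * (Lc : ℝ) * (Real.exp κ + 1)) * C))) * (C * (Φ₀ * Real.exp κ))) with hK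
  refine ⟨κ, K, ϑ, hκ, by positivity, hϑ0, hϑ1, fun r hr rr hrr k κ' u' α x' β z' => ?_⟩
  obtain ⟨m1, m2, m3, m4, m5⟩ := hmaj k
  have hL1 : (1 : ℝ) ≤ (Lc : ℝ) := by exact_mod_cast (show 1 ≤ Lc by omega)
  have m4' : ((Lc : ℝ) ^ (k + 2))⁻¹ ≤ ϑ ^ k :=
    (inv_anti₀ (by positivity) (pow_le_pow_right₀ hL1 (by omega))).trans m4
  have m5' : ((k : ℝ) + 2) * ((Lc : ℝ) ^ (k + 1))⁻¹ ≤ 2 * Kρ * ϑ ^ k := by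
    have hk0 : (0 : ℝ) ≤ k := Nat.cast_nonneg k
    have hi0 : 0 ≤ ((Lc : ℝ) ^ (k + 1))⁻¹ := by positivity
    nlinarith [m5, mul_nonneg hk0 hi0]
  have hbr : Real.exp κ * ((2 * (8 * (Lc : ℝ) * C + F * (1 + 8 * (Lc : ℝ) * (Real.exp κ + 1)) * C)) * (c₁ * θ₁ ^ k) * (Φ₀ * Real.exp κ) + (2 * (8 * (Lc : ℝ) * C + F * (1 + 8 * (Lc : ℝ) * (Real.exp κ + 1)) * C)) * C * (A * θt ^ k + B * ((Lc : ℝ) ^ (k + 1))⁻¹)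
              + (3 * αd * θ ^ k + 2 * α₀ * ((Lc : ℝ) ^ (k + 2))⁻¹) * C * (Φ₀ * Real.exp κ))
            + 2 * Real.exp κ * (((k : ℝ) + 2) * (((8 * (Lc : ℝ) * C + F * (1 + 8 * (Lc : ℝ) * (Real.exp κ + 1)) * C)) * ((Lc : ℝ) ^ (k + 1))⁻¹)) * (C * (Φ₀ * Real.exp κ))
      ≤ (Real.exp κ * ((2 * (8 * (Lc : ℝ) * C + F * (1 + 8 * (Lc : ℝ) * (Real.exp κ + 1)) * C)) * (c₁ * 1) * (Φ₀ * Real.exp κ) + (2 * (8 * (Lc : ℝ) * C + F * (1 + 8 * (Lc : ℝ) * (Real.exp κ + 1)) * C)) * C * (A * 1 + B * 1) + (3 * αd * 1 + 2 * α₀ * 1) * C * (Φ₀ * Real.exp κ))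
          + 2 * Real.exp κ * ((2 * Kρ * 1) * ((8 * (Lc : ℝ) * C + F * (1 + 8 * (Lc : ℝ) * (Real.exp κ + 1)) * C))) * (C * (Φ₀ * Real.exp κ))) * ϑ ^ k := by
    have eq : (Real.exp κ * ((2 * (8 * (Lc : ℝ) * C + F * (1 + 8 * (Lc : ℝ) * (Real.exp κ + 1)) * C)) * (c₁ * 1) * (Φ₀ * Real.exp κ) + (2 * (8 * (Lc : ℝ) * C + F * (1 + 8 * (Lc : ℝ) * (Real.exp κ + 1)) * C)) * C * (A * 1 + B * 1) + (3 * αd * 1 + 2 * α₀ * 1) * C * (Φ₀ * Real.exp κ))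
          + 2 * Real.exp κ * ((2 * Kρ * 1) * ((8 * (Lc : ℝ) * C + F * (1 + 8 * (Lc : ℝ) * (Real.exp κ + 1)) * C))) * (C * (Φ₀ * Real.exp κ))) * ϑ ^ k
        = Real.exp κ * ((2 * (8 * (Lc : ℝ) * C + F * (1 + 8 * (Lc : ℝ) * (Real.exp κ + 1)) * C)) * (c₁ * ϑ ^ k) * (Φ₀ * Real.exp κ) + (2 * (8 * (Lc : ℝ) * C + F * (1 + 8 * (Lc : ℝ) * (Real.exp κ + 1)) * C)) * C * (A * ϑ ^ k + B * ϑ ^ k)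
              + (3 * αd * ϑ ^ k + 2 * α₀ * ϑ ^ k) * C * (Φ₀ * Real.exp κ))
            + 2 * Real.exp κ * ((2 * Kρ * ϑ ^ k) * ((8 * (Lc : ℝ) * C + F * (1 + 8 * (Lc : ℝ) * (Real.exp κ + 1)) * C))) * (C * (Φ₀ * Real.exp κ)) := by ring
    rw [eq, show ((k : ℝ) + 2) * (((8 * (Lc : ℝ) * C + F * (1 + 8 * (Lc : ℝ) * (Real.exp κ + 1)) * C)) * ((Lc : ℝ) ^ (k + 1))⁻¹) = (((k : ℝ) + 2) * ((Lc : ℝ) ^ (k + 1))⁻¹) * ((8 * (Lc : ℝ) * C + F * (1 + 8 * (Lc : ℝ) * (Real.exp κ + 1)) * C)) by ring]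
    gcongr
  have h := abs_atomTip_refine_le hLc hr hrr (hF r hr) hκ hC hΦ hc₁ hθ₁ hA hB hθt hαd hα₀ hθ hN1 ht hdB hdt (hdl r hr rr hrr) k κ' u' α x' β z'
  refine h.trans ?_
  have hZ : 0 ≤ Zl (3 + 1) (κ / (4 * ((((3 : ℕ) : ℝ)) + 1))) * Real.exp (-(κ / 12) * (supNorm (u' - x') + supNorm (z' - x'))) := by
    have hc' : 0 < κ / (4 * ((((3 : ℕ) : ℝ)) + 1)) := by positivity
    exact mul_nonneg (Zl_nonneg hc') (Real.exp_pos _).le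
  have h4 : (0 : ℝ) ≤ (((3 : ℕ) : ℝ)) + 1 := by positivity
  rw [hK]
  calc _ ≤ ((((3 : ℕ) : ℝ)) + 1) * (_ * ϑ ^ k) * (Zl (3 + 1) (κ / (4 * ((((3 : ℕ) : ℝ)) + 1))) * Real.exp (-(κ / 12) * (supNorm (u' - x') + supNorm (z' - x')))) :=
        mul_le_mul_of_nonneg_right (mul_le_mul_of_nonneg_left hbr h4) hZ
    _ = _ := by ring

/-- NOT IN PRINT; OUR BOOKKEEPING.  **THE MIDPOINT B-ATOM, THE SAME.** -/
theorem exists_atomMid_refine_three (hLc : 2 ≤ Lc) :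
    ∃ κ K ϑ : ℝ, 0 < κ ∧ 0 ≤ K ∧ 0 ≤ ϑ ∧ ϑ < 1 ∧
      ∀ (r : Fin (3 + 1) → ℕ), r ∈ box (3 + 1) Lc → ∀ (rr : Fin (3 + 1) → ℕ), rr ∈ box (3 + 1) Lc →
        ∀ (k : ℕ) (κ' : Fin (3 + 1)) (u' : Site (3 + 1)) (α : Fin (3 + 1)) (x' : Site (3 + 1)) (β : Fin (3 + 1)) (z' : Site (3 + 1)),
          |((Lc : ℝ) ^ (k + 2)) ^ 12 *
          (∑' x : Site (3 + 1), ∑ κ,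
            ((Psi (toSite rr) Lc 0 (k + 1) (delta1 α x') + PsiFace r (toSite rr) Lc 0 (k + 1) (delta1 α x') - bmGaugeAt (toSite rr) (respStep (d := 3) 1 (Lc ^ (k + 2)) α x') Lc) x + (Psi (toSite rr) Lc 0 (k + 1) (delta1 α x') + PsiFace r (toSite rr) Lc 0 (k + 1) (delta1 α x') - bmGaugeAt (toSite rr) (respStep (d := 3) 1 (Lc ^ (k + 2)) α x') Lc) (x + unitVec κ)) / 2
              * respStep (d := 3) 1 (Lc ^ (k + 2)) κ' u' κ x
              * contourSumAdj (Lc ^ (k + 2)) (fun l y => wΦ (N := Lc ^ (k + 2)) (d := 3) l β (y - z')) κ x)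
          - ((Lc : ℝ) ^ (k + 1)) ^ 12 *
          (∑' cc : Site (3 + 1), ∑ κ,
            ((Psi (toSite rr) Lc 0 k (delta1 α x') + PsiFace r (toSite rr) Lc 0 k (delta1 α x') - bmGaugeAt (toSite rr) (respStep (d := 3) 1 (Lc ^ (k + 1)) α x') Lc) cc + (Psi (toSite rr) Lc 0 k (delta1 α x') + PsiFace r (toSite rr) Lc 0 k (delta1 α x') - bmGaugeAt (toSite rr) (respStep (d := 3) 1 (Lc ^ (k + 1)) α x') Lc) (cc + unitVec κ)) / 2
              * respStep (d := 3) 1 (Lc ^ (k + 1)) κ' u' κ cc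
              * contourSumAdj (Lc ^ (k + 1)) (fun l y => wΦ (N := Lc ^ (k + 1)) (d := 3) l β (y - z')) κ cc)|
          ≤ K * ϑ ^ k * (Zl (3 + 1) (κ / (4 * ((((3 : ℕ) : ℝ)) + 1))) * Real.exp (-(κ / 12) * (supNorm (u' - x') + supNorm (z' - x')))) := by
  obtain ⟨κ, C, Φ₀, c₁, θ₁, A, B, θt, αd, α₀, θ, F, hκ, hC, hΦ, hc₁, hθ₁, hθ₁1, hA, hB, hθt, hθt1, hαd, hα₀, hθ, hθ1, hF, hN1, ht, hdB, hdt, hdl⟩ :=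
    exists_common_refine_letters_three (Lc := Lc) hLc
  have hF0 : 0 ≤ F := (faceWtSum_nonneg _ Lc).trans (hF _ (AveragingContoursRooted.ctrOff_mem_box (by omega)))
  obtain ⟨ϑ, Kρ, hϑ0, hϑ1, hKρ, hmaj⟩ := ContactRefineBHolds.exists_geometric_majorant (Lc := Lc) hLc hθ₁ hθ₁1 hθt hθt1 hθ hθ1
  have hKρ0 : 0 ≤ Kρ := zero_le_one.trans hKρ
  have hL0 : (0 : ℝ) ≤ (Lc : ℝ) := Nat.cast_nonneg _
  set K : ℝ := ((((3 : ℕ) : ℝ)) + 1) *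
      (Real.exp κ * ((2 * (8 * (Lc : ℝ) * C + F * (1 + 8 * (Lc : ℝ) * (Real.exp κ + 1)) * C)) * (c₁ * 1) * (Φ₀ * Real.exp κ) + (2 * (8 * (Lc : ℝ) * C + F * (1 + 8 * (Lc : ℝ) * (Real.exp κ + 1)) * C)) * C * (A * 1 + B * 1) + (3 * αd * 1 + 2 * α₀ * 1) * C * (Φ₀ * Real.exp κ))
        + 2 * Real.exp κ * ((2 * Kρ * 1) * ((8 * (Lc : ℝ) * C + F * (1 + 8 * (Lc : ℝ) * (Real.exp κ + 1)) * C))) * (C * (Φ₀ * Real.exp κ))) with hK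
  refine ⟨κ, K, ϑ, hκ, by positivity, hϑ0, hϑ1, fun r hr rr hrr k κ' u' α x' β z' => ?_⟩
  obtain ⟨m1, m2, m3, m4, m5⟩ := hmaj k
  have hL1 : (1 : ℝ) ≤ (Lc : ℝ) := by exact_mod_cast (show 1 ≤ Lc by omega)
  have m4' : ((Lc : ℝ) ^ (k + 2))⁻¹ ≤ ϑ ^ k :=
    (inv_anti₀ (by positivity) (pow_le_pow_right₀ hL1 (by omega))).trans m4
  have m5' : ((k : ℝ) + 2) * ((Lc : ℝ) ^ (k + 1))⁻¹ ≤ 2 * Kρ * ϑ ^ k := by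
    have hk0 : (0 : ℝ) ≤ k := Nat.cast_nonneg k
    have hi0 : 0 ≤ ((Lc : ℝ) ^ (k + 1))⁻¹ := by positivity
    nlinarith [m5, mul_nonneg hk0 hi0]
  have hbr : Real.exp κ * ((2 * (8 * (Lc : ℝ) * C + F * (1 + 8 * (Lc : ℝ) * (Real.exp κ + 1)) * C)) * (c₁ * θ₁ ^ k) * (Φ₀ * Real.exp κ) + (2 * (8 * (Lc : ℝ) * C + F * (1 + 8 * (Lc : ℝ) * (Real.exp κ + 1)) * C)) * C * (A * θt ^ k + B * ((Lc : ℝ) ^ (k + 1))⁻¹)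
              + (3 * αd * θ ^ k + 2 * α₀ * ((Lc : ℝ) ^ (k + 2))⁻¹) * C * (Φ₀ * Real.exp κ))
            + 2 * Real.exp κ * (((k : ℝ) + 2) * (((8 * (Lc : ℝ) * C + F * (1 + 8 * (Lc : ℝ) * (Real.exp κ + 1)) * C)) * ((Lc : ℝ) ^ (k + 1))⁻¹)) * (C * (Φ₀ * Real.exp κ))
      ≤ (Real.exp κ * ((2 * (8 * (Lc : ℝ) * C + F * (1 + 8 * (Lc : ℝ) * (Real.exp κ + 1)) * C)) * (c₁ * 1) * (Φ₀ * Real.exp κ) + (2 * (8 * (Lc : ℝ) * C + F * (1 + 8 * (Lc : ℝ) * (Real.exp κ + 1)) * C)) * C * (A * 1 + B * 1) + (3 * αd * 1 + 2 * α₀ * 1) * C * (Φ₀ * Real.exp κ))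
          + 2 * Real.exp κ * ((2 * Kρ * 1) * ((8 * (Lc : ℝ) * C + F * (1 + 8 * (Lc : ℝ) * (Real.exp κ + 1)) * C))) * (C * (Φ₀ * Real.exp κ))) * ϑ ^ k := by
    have eq : (Real.exp κ * ((2 * (8 * (Lc : ℝ) * C + F * (1 + 8 * (Lc : ℝ) * (Real.exp κ + 1)) * C)) * (c₁ * 1) * (Φ₀ * Real.exp κ) + (2 * (8 * (Lc : ℝ) * C + F * (1 + 8 * (Lc : ℝ) * (Real.exp κ + 1)) * C)) * C * (A * 1 + B * 1) + (3 * αd * 1 + 2 * α₀ * 1) * C * (Φ₀ * Real.exp κ))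
          + 2 * Real.exp κ * ((2 * Kρ * 1) * ((8 * (Lc : ℝ) * C + F * (1 + 8 * (Lc : ℝ) * (Real.exp κ + 1)) * C))) * (C * (Φ₀ * Real.exp κ))) * ϑ ^ k
        = Real.exp κ * ((2 * (8 * (Lc : ℝ) * C + F * (1 + 8 * (Lc : ℝ) * (Real.exp κ + 1)) * C)) * (c₁ * ϑ ^ k) * (Φ₀ * Real.exp κ) + (2 * (8 * (Lc : ℝ) * C + F * (1 + 8 * (Lc : ℝ) * (Real.exp κ + 1)) * C)) * C * (A * ϑ ^ k + B * ϑ ^ k)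
              + (3 * αd * ϑ ^ k + 2 * α₀ * ϑ ^ k) * C * (Φ₀ * Real.exp κ))
            + 2 * Real.exp κ * ((2 * Kρ * ϑ ^ k) * ((8 * (Lc : ℝ) * C + F * (1 + 8 * (Lc : ℝ) * (Real.exp κ + 1)) * C))) * (C * (Φ₀ * Real.exp κ)) := by ring
    rw [eq, show ((k : ℝ) + 2) * (((8 * (Lc : ℝ) * C + F * (1 + 8 * (Lc : ℝ) * (Real.exp κ + 1)) * C)) * ((Lc : ℝ) ^ (k + 1))⁻¹) = (((k : ℝ) + 2) * ((Lc : ℝ) ^ (k + 1))⁻¹) * ((8 * (Lc : ℝ) * C + F * (1 + 8 * (Lc : ℝ) * (Real.exp κ + 1)) * C)) by ring]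
    gcongr
  have h := abs_atomMid_refine_le hLc hr hrr (hF r hr) hκ hC hΦ hc₁ hθ₁ hA hB hθt hαd hα₀ hθ hN1 ht hdB hdt (hdl r hr rr hrr) k κ' u' α x' β z'
  refine h.trans ?_
  have hZ : 0 ≤ Zl (3 + 1) (κ / (4 * ((((3 : ℕ) : ℝ)) + 1))) * Real.exp (-(κ / 12) * (supNorm (u' - x') + supNorm (z' - x'))) := by
    have hc' : 0 < κ / (4 * ((((3 : ℕ) : ℝ)) + 1)) := by positivity
    exact mul_nonneg (Zl_nonneg hc') (Real.exp_pos _).le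
  have h4 : (0 : ℝ) ≤ (((3 : ℕ) : ℝ)) + 1 := by positivity
  rw [hK]
  calc _ ≤ ((((3 : ℕ) : ℝ)) + 1) * (_ * ϑ ^ k) * (Zl (3 + 1) (κ / (4 * ((((3 : ℕ) : ℝ)) + 1))) * Real.exp (-(κ / 12) * (supNorm (u' - x') + supNorm (z' - x')))) :=
        mul_le_mul_of_nonneg_right (mul_le_mul_of_nonneg_left hbr h4) hZ
    _ = _ := by ring

/-- NOT IN PRINT; OUR BOOKKEEPING.  **THE SITE B-ATOM, THE SAME** (no weight wobble, no realignment). -/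
theorem exists_atomSite_refine_three (hLc : 2 ≤ Lc) :
    ∃ κ K ϑ : ℝ, 0 < κ ∧ 0 ≤ K ∧ 0 ≤ ϑ ∧ ϑ < 1 ∧
      ∀ (r : Fin (3 + 1) → ℕ), r ∈ box (3 + 1) Lc → ∀ (rr : Fin (3 + 1) → ℕ), rr ∈ box (3 + 1) Lc →
        ∀ (k : ℕ) (κ' : Fin (3 + 1)) (u' : Site (3 + 1)) (α : Fin (3 + 1)) (x' : Site (3 + 1)) (β : Fin (3 + 1)) (z' : Site (3 + 1)),
          |((Lc : ℝ) ^ (k + 2)) ^ 12 *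
          (∑' x : Site (3 + 1), ∑ κ,
            (Psi (toSite rr) Lc 0 (k + 1) (delta1 α x') + PsiFace r (toSite rr) Lc 0 (k + 1) (delta1 α x') - bmGaugeAt (toSite rr) (respStep (d := 3) 1 (Lc ^ (k + 2)) α x') Lc) x
              * respStep (d := 3) 1 (Lc ^ (k + 2)) κ' u' κ x
              * contourSumAdj (Lc ^ (k + 2)) (fun l y => wΦ (N := Lc ^ (k + 2)) (d := 3) l β (y - z')) κ x)
          - ((Lc : ℝ) ^ (k + 1)) ^ 12 *
          (∑' cc : Site (3 + 1), ∑ κ,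
            (Psi (toSite rr) Lc 0 k (delta1 α x') + PsiFace r (toSite rr) Lc 0 k (delta1 α x') - bmGaugeAt (toSite rr) (respStep (d := 3) 1 (Lc ^ (k + 1)) α x') Lc) cc
              * respStep (d := 3) 1 (Lc ^ (k + 1)) κ' u' κ cc
              * contourSumAdj (Lc ^ (k + 1)) (fun l y => wΦ (N := Lc ^ (k + 1)) (d := 3) l β (y - z')) κ cc)|
          ≤ K * ϑ ^ k * (Zl (3 + 1) (κ / (4 * ((((3 : ℕ) : ℝ)) + 1))) * Real.exp (-(κ / 12) * (supNorm (u' - x') + supNorm (z' - x')))) := by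
  obtain ⟨κ, C, Φ₀, c₁, θ₁, A, B, θt, αd, α₀, θ, F, hκ, hC, hΦ, hc₁, hθ₁, hθ₁1, hA, hB, hθt, hθt1, hαd, hα₀, hθ, hθ1, hF, hN1, ht, hdB, hdt, hdl⟩ :=
    exists_common_refine_letters_three (Lc := Lc) hLc
  have hF0 : 0 ≤ F := (faceWtSum_nonneg _ Lc).trans (hF _ (AveragingContoursRooted.ctrOff_mem_box (by omega)))
  obtain ⟨ϑ, Kρ, hϑ0, hϑ1, hKρ, hmaj⟩ := ContactRefineBHolds.exists_geometric_majorant (Lc := Lc) hLc hθ₁ hθ₁1 hθt hθt1 hθ hθ1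
  have hKρ0 : 0 ≤ Kρ := zero_le_one.trans hKρ
  have hL0 : (0 : ℝ) ≤ (Lc : ℝ) := Nat.cast_nonneg _
  set K : ℝ := ((((3 : ℕ) : ℝ)) + 1) *
      ((2 * (8 * (Lc : ℝ) * C + F * (1 + 8 * (Lc : ℝ) * (Real.exp κ + 1)) * C)) * (c₁ * 1) * (Φ₀ * Real.exp κ) + (2 * (8 * (Lc : ℝ) * C + F * (1 + 8 * (Lc : ℝ) * (Real.exp κ + 1)) * C)) * C * (A * 1 + B * 1) + (3 * αd * 1 + 2 * α₀ * 1) * C * (Φ₀ * Real.exp κ)) with hK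
  refine ⟨κ, K, ϑ, hκ, by positivity, hϑ0, hϑ1, fun r hr rr hrr k κ' u' α x' β z' => ?_⟩
  obtain ⟨m1, m2, m3, m4, m5⟩ := hmaj k
  have hL1 : (1 : ℝ) ≤ (Lc : ℝ) := by exact_mod_cast (show 1 ≤ Lc by omega)
  have m4' : ((Lc : ℝ) ^ (k + 2))⁻¹ ≤ ϑ ^ k :=
    (inv_anti₀ (by positivity) (pow_le_pow_right₀ hL1 (by omega))).trans m4
  have m5' : ((k : ℝ) + 2) * ((Lc : ℝ) ^ (k + 1))⁻¹ ≤ 2 * Kρ * ϑ ^ k := by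
    have hk0 : (0 : ℝ) ≤ k := Nat.cast_nonneg k
    have hi0 : 0 ≤ ((Lc : ℝ) ^ (k + 1))⁻¹ := by positivity
    nlinarith [m5, mul_nonneg hk0 hi0]
  have hbr : (2 * (8 * (Lc : ℝ) * C + F * (1 + 8 * (Lc : ℝ) * (Real.exp κ + 1)) * C)) * (c₁ * θ₁ ^ k) * (Φ₀ * Real.exp κ) + (2 * (8 * (Lc : ℝ) * C + F * (1 + 8 * (Lc : ℝ) * (Real.exp κ + 1)) * C)) * C * (A * θt ^ k + B * ((Lc : ℝ) ^ (k + 1))⁻¹)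
              + (3 * αd * θ ^ k + 2 * α₀ * ((Lc : ℝ) ^ (k + 2))⁻¹) * C * (Φ₀ * Real.exp κ)
      ≤ ((2 * (8 * (Lc : ℝ) * C + F * (1 + 8 * (Lc : ℝ) * (Real.exp κ + 1)) * C)) * (c₁ * 1) * (Φ₀ * Real.exp κ) + (2 * (8 * (Lc : ℝ) * C + F * (1 + 8 * (Lc : ℝ) * (Real.exp κ + 1)) * C)) * C * (A * 1 + B * 1) + (3 * αd * 1 + 2 * α₀ * 1) * C * (Φ₀ * Real.exp κ)) * ϑ ^ k := by
    have eq : ((2 * (8 * (Lc : ℝ) * C + F * (1 + 8 * (Lc : ℝ) * (Real.exp κ + 1)) * C)) * (c₁ * 1) * (Φ₀ * Real.exp κ) + (2 * (8 * (Lc : ℝ) * C + F * (1 + 8 * (Lc : ℝ) * (Real.exp κ + 1)) * C)) * C * (A * 1 + B * 1) + (3 * αd * 1 + 2 * α₀ * 1) * C * (Φ₀ * Real.exp κ)) * ϑ ^ k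
        = (2 * (8 * (Lc : ℝ) * C + F * (1 + 8 * (Lc : ℝ) * (Real.exp κ + 1)) * C)) * (c₁ * ϑ ^ k) * (Φ₀ * Real.exp κ) + (2 * (8 * (Lc : ℝ) * C + F * (1 + 8 * (Lc : ℝ) * (Real.exp κ + 1)) * C)) * C * (A * ϑ ^ k + B * ϑ ^ k)
              + (3 * αd * ϑ ^ k + 2 * α₀ * ϑ ^ k) * C * (Φ₀ * Real.exp κ) := by ring
    rw [eq]
    gcongr
  have h := abs_atomSite_refine_le hLc hr hrr (hF r hr) hκ hC hΦ hc₁ hθ₁ hA hB hθt hαd hα₀ hθ hN1 ht hdB hdt (hdl r hr rr hrr) k κ' u' α x' β z'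
  refine h.trans ?_
  have hZ : 0 ≤ Zl (3 + 1) (κ / (4 * ((((3 : ℕ) : ℝ)) + 1))) * Real.exp (-(κ / 12) * (supNorm (u' - x') + supNorm (z' - x'))) := by
    have hc' : 0 < κ / (4 * ((((3 : ℕ) : ℝ)) + 1)) := by positivity
    exact mul_nonneg (Zl_nonneg hc') (Real.exp_pos _).le
  have h4 : (0 : ℝ) ≤ (((3 : ℕ) : ℝ)) + 1 := by positivity
  rw [hK]
  calc _ ≤ ((((3 : ℕ) : ℝ)) + 1) * (_ * ϑ ^ k) * (Zl (3 + 1) (κ / (4 * ((((3 : ℕ) : ℝ)) + 1))) * Real.exp (-(κ / 12) * (supNorm (u' - x') + supNorm (z' - x')))) :=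
        mul_le_mul_of_nonneg_right (mul_le_mul_of_nonneg_left hbr h4) hZ
    _ = _ := by ring

end Summit.QuantumFields.BalabanUV.Beta.GAN24.CombContactRefineBHolds

end
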